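import Mathlib
import Summits.ValiantsHypothesis.ValiantsHypothesis.Theorems.BarrierLeverPartitionMinorsHitByVPSimplexJoinTwoLive
import Summits.ValiantsHypothesis.ValiantsHypothesis.Theorems.BarrierLeverPartitionMinorsHitByVPSimplexJoinMenuReduction

/-!
# Route BarrierLever — item `PartitionMinorsHitByVP` (19717): `Stmt.pieceKill` REDUCED to pieces with ≥ 3 live slots
Helper file (`--supports stmt-ValiantsHypothesis-19717`; cell valiant-natproofs, 𝒟-side door (c), line `hidden_states`, uniform-menu
lane; prover seat val-np-p3 gen 12). One `Prop` definition (`Stmt.pieceKillMany`, NOT asserted) and its kernel consequences. Closes NO item.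
With the k = 2 part of the case map in the kernel (`pieceKill_twoLive`, p636762), the piece-level statement `Stmt.pieceKill` (p633734) —
and with it `¬ Stmt.uniformMenuSimplex` — now hinges only on pieces with AT LEAST THREE live slots:
* `Stmt.pieceKillMany H₀` (typed here): the clause of `Stmt.pieceKill H₀` restricted to one-piece designs with `≥ 3` live slots
  (`3 ≤ #{f : (S 0 f).Nonempty}`);
* **`pieceKill_of_pieceKillMany : Stmt.pieceKillMany H₀ → Stmt.pieceKill (max H₀ (2^40))`** (two live slots and no third ⇒
  `pieceKill_twoLive` after ordering the two sizes; otherwise the hypothesis);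
* **`not_uniformMenuSimplex_of_pieceKillMany : Stmt.pieceKillMany H₀ → ¬ Stmt.uniformMenuSimplex`** (with p633734).
What remains (memo val-np-p3 g12 §2(f)–(g)): `Stmt.pieceKillMany H₀` — ≥ 6 live slots by the six-slot lemma at `A = univ` (rows ≤ 5,
`n ≤ C(h,5)`), 3–5 live slots by the k-slot lemmas (deep: level sum ≥ 6 at `univ`; shallow patterns (0,0,0),(1,0,0),(1,1,0),(2,0,0),(0⁴),
(1,0³),(0⁵) inside sub-ambients as in the `…Pattern*` files). Nothing on crux 14610 or VP ≠ VNP; item 19717 stays OPEN.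
-/

set_option linter.dupNamespace false

namespace Summit.ValiantsHypothesis.ValiantsHypothesis.Theorems.BarrierLever.SimplexJoin

open Finset Matrix

/-- **The residual piece-level statement (typed, not asserted):** `Stmt.pieceKill` for one-piece designs with at least three live slots. -/
def Stmt.pieceKillMany (H₀ : ℕ) : Prop :=
  ∀ h : ℕ, H₀ ≤ h → ∀ (D N n : ℕ) (S : Fin 1 → Fin D → Finset (Fin N)) (e : Fin n → Fin 1 × (Fin D → Option (Fin N))),
    D ≤ h + h → N ≤ (h + h) ^ 2 → Function.Injective e →
    (∀ c : Fin 1 × (Fin D → Option (Fin N)), c ∈ Set.range e ↔ ∀ (f : Fin D) (j : Fin N), c.2 f = some j → j ∈ S c.1 f) →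
    3 ≤ (Finset.univ.filter fun f : Fin D => (S 0 f).Nonempty).card →
    (h + h) ^ 2 + 2 ≤ n → n ≤ (h + h) ^ 2 * ((h + h) ^ 2 + 1) + 1 →
    ∃ v : Fin n → Finset (Fin h), Function.Injective v ∧
      ∀ T : Fin 1 → Option (Fin D × Fin N) → Fin h → ℂ,
        (Matrix.of fun x x' : Fin n => ∏ a ∈ v x,
          (T (e x').1 none a + ∑ f : Fin D, ((e x').2 f).elim 0 fun j => T (e x').1 (some (f, j)) a)).det = 0

/-- **`Stmt.pieceKill` from its ≥ 3-live-slot part.** -/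
theorem pieceKill_of_pieceKillMany (H₀ : ℕ) (hM : Stmt.pieceKillMany H₀) : Stmt.pieceKill (max H₀ (2 ^ 40)) := by
  classical
  intro h hh D N n S e hD hN he hlive htwo hnlo hnhi
  have hH₀ : H₀ ≤ h := le_trans (le_max_left _ _) hh
  have h40 : 2 ^ 40 ≤ h := le_trans (le_max_right _ _) hh
  obtain ⟨f₁, f₂, hf, hS₁, hS₂⟩ := htwo
  by_cases hthird : ∃ f₃, f₃ ≠ f₁ ∧ f₃ ≠ f₂ ∧ (S 0 f₃).Nonempty
  · -- at least three live slots
    obtain ⟨f₃, h31, h32, hS₃⟩ := hthird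
    refine hM h hH₀ D N n S e hD hN he hlive ?_ hnlo hnhi
    have hsub : ({f₁, f₂, f₃} : Finset (Fin D)) ⊆ Finset.univ.filter fun f : Fin D => (S 0 f).Nonempty := by
      intro f hf'
      simp only [Finset.mem_insert, Finset.mem_singleton] at hf'
      simp only [Finset.mem_filter, Finset.mem_univ, true_and]
      rcases hf' with rfl | rfl | rfl
      exacts [hS₁, hS₂, hS₃]
    have hcard : ({f₁, f₂, f₃} : Finset (Fin D)).card = 3 := by
      rw [Finset.card_insert_of_notMem, Finset.card_insert_of_notMem, Finset.card_singleton]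
      · simpa using h32.symm
      · simp only [Finset.mem_insert, Finset.mem_singleton, not_or]; exact ⟨hf, h31.symm⟩
    exact hcard ▸ Finset.card_le_card hsub
  · -- exactly two live slots: order them and apply `pieceKill_twoLive`
    push Not at hthird
    have hdead : ∀ f, f ≠ f₁ → f ≠ f₂ → S 0 f = ∅ := fun f h1 h2 => hthird f h1 h2
    have hcardN : ∀ f, (S 0 f).card ≤ (h + h) ^ 2 := fun f =>
      (Finset.card_le_univ _).trans (by simp; exact hN)
    rcases le_total (S 0 f₂).card (S 0 f₁).card with hle | hle
    · exact pieceKill_twoLive h D N n h40 S e he hlive f₁ f₂ hf hle (Finset.card_pos.mpr hS₂) (hcardN f₁) hdead hnlo hnhi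
    · exact pieceKill_twoLive h D N n h40 S e he hlive f₂ f₁ hf.symm hle (Finset.card_pos.mpr hS₁) (hcardN f₂)
        (fun f h2 h1 => hdead f h1 h2) hnlo hnhi

/-- **The uniform simplex menu now hinges on pieces with ≥ 3 live slots.** -/
theorem not_uniformMenuSimplex_of_pieceKillMany (H₀ : ℕ) (hM : Stmt.pieceKillMany H₀) : ¬ Stmt.uniformMenuSimplex :=
  not_uniformMenuSimplex_of_pieceKill _ (pieceKill_of_pieceKillMany H₀ hM)

end Summit.ValiantsHypothesis.ValiantsHypothesis.Theorems.BarrierLever.SimplexJoin
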